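import Summits.Parity.GeneralizedHardyLittlewood.Theorems.BeyondDiagonalBeatsQuarter.OffDiagDualCompletionTwisted
import HarnessLib

/-!
# Route `PrimeLevelFamEdge`, crux K_B (stmt-Parity-20343), line `diagonal_kernel_split` rev 4, plan Ω,
# sub-line Ω-e (OMEGA-BLUEPRINT L6′) — complete `s`-sums along a SIGNED integer modulus `h₁`:
# the principal part of the dual box term lives only on `|h₁| <` (box height)

After the divisor switch the second dual frequency of the box term is `ξ₂ = s/h₁ + τ` with a SIGNED modulus `h₁ ∈ ℤ ∖ {0}`
(`OffDiagDivisorSwitch`), and the principal part of the level sum (`OffDiagLevelAP.levelPrincipal`) carries the complete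
`s`-sum. `OffDiagDualCompletion*` treat a modulus `h ∈ ℕ`; this file transfers to signed `h₁` (re-index `s ↦ −s`):

* `tsum_int_comp_neg` bookkeeping; **`tsum_fourier2_intShift_eq`** — `Σ_{s∈ℤ} Φ̂(ξ₁, s/h₁ + τ) = |h₁|·Σ_k e(−τ|h₁|k)·𝓕₁Φ(ξ₁; |h₁|k)`;
* **`tsum_fourier2_intShift_eq_zero`** — if `Φ(t₁,t₂) ≠ 0 ⇒ 0 < t₂ < B` and `B ≤ |h₁|`, the complete `s`-sum VANISHES: the
  principal part of the dual box term is supported on the short signed moduli `0 < |h₁| < B` (`B = 2^{i₂+1}` for box `i`);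
* `support_height_of_box` — the support hypothesis in the form the dyadic boxes of Ω-d5 supply (`K₂/2 < t₂ < 2K₂`); the
  twisted (`e(js/|h₁|)`) versions are `OffDiagDualCompletionTwisted.tsum_fourierChar_mul_fourier2_shift_eq(_single)` at `h = |h₁|`.

Folklore; theorems only; standard axioms. Helper toward `stub_offDiagBelowSlack_io`; closes nothing.
«The programme SEARCHES and TYPES; no claim about Landau–Siegel zeros, Theorems 1–2 of arXiv:2211.02515 or
a repaired Margin232 until a kernel theorem says so.»
-/

noncomputable section

open Real MeasureTheory Filter Complex Set
open scoped FourierTransform Topology ContDiff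

namespace Summit.Parity.GeneralizedHardyLittlewood.Theorems.BeyondDiagonalBeatsQuarter.OffDiag

open Literature.NumberTheory.Sieve.FriedlanderIwaniecPrimes

variable {Φ : ℝ → ℝ → ℂ}

/-- `s/h₁ = (−s)/|h₁|` for `h₁ < 0`. [folklore] -/
theorem div_eq_neg_div_natAbs_of_neg {h₁ : ℤ} (hneg : h₁ < 0) (s : ℤ) :
    (s : ℝ) / (h₁ : ℝ) = ((-s : ℤ) : ℝ) / (h₁.natAbs : ℝ) := by
  have habs : ((h₁.natAbs : ℕ) : ℝ) = -(h₁ : ℝ) := by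
    rw [Nat.cast_natAbs, abs_of_neg (by exact_mod_cast hneg), Int.cast_neg]
  rw [habs]
  push_cast
  rw [neg_div_neg_eq]

/-- **Complete `s`-sums along a signed modulus**: for `uncurry Φ` smooth of compact support, `h₁ ≠ 0`, `τ, ξ₁ ∈ ℝ`:
`Σ_{s∈ℤ} fourier2 Φ ξ₁ (s/h₁ + τ) = |h₁|·Σ_{k∈ℤ} e(−τ|h₁|k)·𝓕(t₁ ↦ Φ(t₁, |h₁|k))(ξ₁)`. [folklore] -/
theorem tsum_fourier2_intShift_eq (hΦ : ContDiff ℝ ∞ (Function.uncurry Φ))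
    (hΦc : HasCompactSupport (Function.uncurry Φ)) {h₁ : ℤ} (hh : h₁ ≠ 0) (τ ξ₁ : ℝ) :
    ∑' s : ℤ, fourier2 Φ ξ₁ ((s : ℝ) / h₁ + τ) =
      (h₁.natAbs : ℂ) * ∑' k : ℤ, (𝐞 (-(τ * (h₁.natAbs * k))) : ℂ) *
        𝓕 (fun t₁ : ℝ ↦ Φ t₁ (h₁.natAbs * k)) ξ₁ := by
  have hpos : 0 < h₁.natAbs := Int.natAbs_pos.mpr hh
  rcases lt_or_gt_of_ne hh with hneg | hposZ
  · -- re-index `s ↦ −s`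
    have hre : ∑' s : ℤ, fourier2 Φ ξ₁ ((s : ℝ) / h₁ + τ) =
        ∑' s : ℤ, fourier2 Φ ξ₁ (((s : ℤ) : ℝ) / (h₁.natAbs : ℝ) + τ) := by
      rw [← (Equiv.neg ℤ).tsum_eq]
      refine tsum_congr fun s ↦ ?_
      rw [Equiv.neg_apply, div_eq_neg_div_natAbs_of_neg hneg, neg_neg]
    rw [hre]
    exact tsum_fourier2_shift_eq hΦ hΦc hpos τ ξ₁
  · have habs : ((h₁.natAbs : ℕ) : ℝ) = (h₁ : ℝ) := by
      rw [Nat.cast_natAbs, abs_of_pos (by exact_mod_cast hposZ)]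
    have hre : ∑' s : ℤ, fourier2 Φ ξ₁ ((s : ℝ) / h₁ + τ) =
        ∑' s : ℤ, fourier2 Φ ξ₁ (((s : ℤ) : ℝ) / (h₁.natAbs : ℝ) + τ) := by
      rw [habs]
    rw [hre]
    exact tsum_fourier2_shift_eq hΦ hΦc hpos τ ξ₁

/-- **The principal part of the dual box term lives on short signed moduli**: if `Φ(t₁,t₂) ≠ 0 ⇒ 0 < t₂ < B` and
`B ≤ |h₁|` (`h₁ ≠ 0`), then `Σ_{s∈ℤ} fourier2 Φ ξ₁ (s/h₁ + τ) = 0`. [folklore] -/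
theorem tsum_fourier2_intShift_eq_zero (hΦ : ContDiff ℝ ∞ (Function.uncurry Φ))
    (hΦc : HasCompactSupport (Function.uncurry Φ)) {B : ℝ} (hsupp : ∀ t₁ t₂, Φ t₁ t₂ ≠ 0 → 0 < t₂ ∧ t₂ < B)
    {h₁ : ℤ} (hh : h₁ ≠ 0) (hB : B ≤ (h₁.natAbs : ℝ)) (τ ξ₁ : ℝ) :
    ∑' s : ℤ, fourier2 Φ ξ₁ ((s : ℝ) / h₁ + τ) = 0 := by
  have hpos : 0 < h₁.natAbs := Int.natAbs_pos.mpr hh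
  have hsupp' : ∀ t₁ t₂, Φ t₁ t₂ ≠ 0 → 0 < t₂ ∧ t₂ < (h₁.natAbs : ℝ) := fun t₁ t₂ h ↦
    ⟨(hsupp t₁ t₂ h).1, lt_of_lt_of_le (hsupp t₁ t₂ h).2 hB⟩
  rcases lt_or_gt_of_ne hh with hneg | hposZ
  · have hre : ∑' s : ℤ, fourier2 Φ ξ₁ ((s : ℝ) / h₁ + τ) =
        ∑' s : ℤ, fourier2 Φ ξ₁ (((s : ℤ) : ℝ) / (h₁.natAbs : ℝ) + τ) := by
      rw [← (Equiv.neg ℤ).tsum_eq]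
      refine tsum_congr fun s ↦ ?_
      rw [Equiv.neg_apply, div_eq_neg_div_natAbs_of_neg hneg, neg_neg]
    rw [hre]
    exact tsum_fourier2_shift_eq_zero hΦ hΦc hpos hsupp' τ ξ₁
  · have habs : ((h₁.natAbs : ℕ) : ℝ) = (h₁ : ℝ) := by
      rw [Nat.cast_natAbs, abs_of_pos (by exact_mod_cast hposZ)]
    have hre : ∑' s : ℤ, fourier2 Φ ξ₁ ((s : ℝ) / h₁ + τ) =
        ∑' s : ℤ, fourier2 Φ ξ₁ (((s : ℤ) : ℝ) / (h₁.natAbs : ℝ) + τ) := by rw [habs]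
    rw [hre]
    exact tsum_fourier2_shift_eq_zero hΦ hΦc hpos hsupp' τ ξ₁

/-- For the dyadic box weights of Ω-d5: `boxWeight … i t₁ t₂ ≠ 0 ⇒ 0 < t₂ < 2^{i₂+1}`, so the complete `s`-sum of a box's
dual term vanishes for every signed modulus with `|h₁| ≥ 2^{i₂+1}`. Stated for an abstract `Φ` living on `(0,∞) × (K₂/2, 2K₂)`:
if `Φ(t₁,t₂) ≠ 0 ⇒ K₂/2 < t₂ ∧ t₂ < 2K₂` then the hypothesis of `tsum_fourier2_intShift_eq_zero` holds with `B = 2K₂`. [folklore] -/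
theorem support_height_of_box {K₂ : ℝ} (hK₂ : 0 < K₂)
    (hbox : ∀ t₁ t₂, Φ t₁ t₂ ≠ 0 → K₂ / 2 < t₂ ∧ t₂ < 2 * K₂) :
    ∀ t₁ t₂, Φ t₁ t₂ ≠ 0 → 0 < t₂ ∧ t₂ < 2 * K₂ := fun t₁ t₂ h ↦
  ⟨lt_trans (by positivity) (hbox t₁ t₂ h).1, (hbox t₁ t₂ h).2⟩

end Summit.Parity.GeneralizedHardyLittlewood.Theorems.BeyondDiagonalBeatsQuarter.OffDiag
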